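import Mathlib
import HarnessLib
import Summits.Ventures.LatticeQCDFlow.Exactness.SphereCapGeometry
import Summits.Ventures.LatticeQCDFlow.Exactness.U1MetropolisSweepErgodic

/-!
# Cap chaining: a kernel that dominates the uniform law of a small cap around every point has a Doeblin power — small moves on a sphere cover it in finitely many steps

HONEST FRAMING: exact (Metropolis-corrected) sampling algorithms for lattice gauge theory;
figures of merit are autocorrelation/cost numbers at stated couplings and volumes; no
continuum-physics claim.

Venture `LatticeQCDFlow` (cell pub-lqcd), topic `Exactness`, FANOUT row 9 (eng-latcore; the covering
half of the `cpn_2d` multi-step / bounded-kick programme — design in HOME/eng-latcore/HANDOFF.md GEN-19;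
the sphere analogue of `ConnectedGroupKickCovering.lean`).  NEW WORK of the cell over Mathlib (Tonelli,
`measurable_measure_prodMk_left`, kernel composition) and the tree (`SphereCapGeometry.lean`: caps, the
halfway point, the positive centre-free cap measure; `InvariantComposition.lean`: `nHit κ n = κ ∘ₖ ⋯ ∘ₖ κ`; `U1MetropolisSweepErgodic.nHit_add`);
nothing is cited as a fact; no number.

THE POINT.  A minorisation `κ(x, ·) ≥ c · μ|_{B(x, r)}` by the reference law restricted to a SMALL ball
around the current point (what a short HMC trajectory or a bounded kick gives) becomes a GLOBAL Doeblin
bound `κ^{2^k}(x, ·) ≥ c' · μ` after finitely many doublings, provided the balls have the HALFWAY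
PROPERTY `μ(B(x, ρ) ∩ B(z, ρ)) ≥ m_ρ > 0` whenever `z ∈ B(x, 3ρ/2)` and exhaust the space at a finite radius.
The doubling step is Tonelli plus the symmetry `z ∈ B(y, ρ) ↔ y ∈ B(z, ρ)`:
`κ^{2n}(x, A) ≥ c_n² ∫_{B(x,ρ)} μ(A ∩ B(y, ρ)) dμ(y) = c_n² ∫_A μ(B(x, ρ) ∩ B(z, ρ)) dμ(z) ≥ c_n² m_ρ μ(A ∩ B(x, 3ρ/2))`.

* §1 (abstract: any measurable space, s-finite `μ`, balls `B x ρ`)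
  `lintegral_restrict_measure_inter_swap` (the Tonelli/symmetry identity), **`chain_step`**
  (`P(n, ρ, c) ⇒ P(2n, ρ', c²m)`), **`chain_iterate`** (radii `(3/2)^j r`, powers `2^j`),
  **`chain_cover`** (balls `= univ` beyond `R₀` ⇒ `∃ k c' > 0, ∀ x, c' • μ ≤ nHit κ (2^k) x`).
* §2 (the sphere, `dim ≥ 2`) `continuous_angle_sphere₂`, `measurableSet_angle_lt`,
  `uniformSphere_cap_inter_cap_ge` (the halfway property of caps), and
  **`sphereCap_chaining`**: if `c • σ|_{cap(x, r)} ≤ κ x` for all `x` (`r > 0`, `c ≠ 0`, `σ` the uniform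
  law) then some power `nHit κ (2^k)` is Doeblin: `c' • σ ≤ nHit κ (2^k) x` for all `x`, `c' ≠ 0` — ready for
  `MetropolisSweepConvergence.uniformlyErgodic_of_nHit_minorised`.

NOT CLAIMED: products of spheres (the `cpn_2d` lattice: the same abstract §1 with `B` = products of caps and
`m` = the product of the one-sphere constants — bookkeeping for the successor), any explicit `k`, `c'`.
-/

noncomputable section

namespace Summit.Ventures.LatticeQCDFlow.Exactness

open MeasureTheory Measure Metric Set Real InnerProductGeometry ProbabilityTheory ProbabilityTheory.Kernel Function
open scoped ENNReal InnerProductSpace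

/-! ## §1 The abstract chaining -/

section Abstract

variable {X : Type*} [MeasurableSpace X]

variable (μ : Measure X) [SFinite μ] (B : X → ℝ → Set X)

/-- Sections of the neighbour relation are the balls; in particular balls are measurable. -/
theorem measurableSet_ball_of_rel {ρ : ℝ} (hN : MeasurableSet {p : X × X | p.2 ∈ B p.1 ρ}) (y : X) :
    MeasurableSet (B y ρ) := by
  have h : MeasurableSet (Prod.mk y ⁻¹' {p : X × X | p.2 ∈ B p.1 ρ}) := measurable_prodMk_left hN
  simpa using h

/-- **The Tonelli/symmetry identity**: `∫_{y ∈ C} μ(A ∩ B(y,ρ)) dμ(y) = ∫_{z ∈ A} μ(C ∩ B(z,ρ)) dμ(z)` when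
`z ∈ B(y, ρ) ↔ y ∈ B(z, ρ)`. -/
theorem lintegral_restrict_measure_inter_swap {ρ : ℝ} (hN : MeasurableSet {p : X × X | p.2 ∈ B p.1 ρ})
    (hsymm : ∀ y z, z ∈ B y ρ ↔ y ∈ B z ρ) {C A : Set X} (hC : MeasurableSet C) (hA : MeasurableSet A) :
    ∫⁻ y in C, μ (A ∩ B y ρ) ∂μ = ∫⁻ z in A, μ (C ∩ B z ρ) ∂μ := by
  have hB : ∀ y, MeasurableSet (B y ρ) := measurableSet_ball_of_rel B hN
  -- the indicator of `T = {(y, z) : y ∈ C, z ∈ A, z ∈ B(y, ρ)}`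
  set T : Set (X × X) := (Prod.fst ⁻¹' C) ∩ ((Prod.snd ⁻¹' A) ∩ {p : X × X | p.2 ∈ B p.1 ρ}) with hT
  have hTm : MeasurableSet T := (measurable_fst hC).inter ((measurable_snd hA).inter hN)
  have hF : Measurable (T.indicator (1 : X × X → ℝ≥0∞)) := measurable_one.indicator hTm
  -- `y`-sections
  have hsecY : ∀ y, (fun z => T.indicator (1 : X × X → ℝ≥0∞) (y, z)) =
      C.indicator (fun _ => (A ∩ B y ρ).indicator (1 : X → ℝ≥0∞)) y := by
    intro y; funext z
    by_cases hy : y ∈ C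
    · rw [indicator_of_mem hy]
      by_cases hz : z ∈ A ∩ B y ρ
      · rw [indicator_of_mem hz, indicator_of_mem (show (y, z) ∈ T from ⟨hy, hz.1, hz.2⟩)]; rfl
      · rw [indicator_of_notMem hz, indicator_of_notMem (show (y, z) ∉ T from fun h => hz ⟨h.2.1, h.2.2⟩)]
    · rw [indicator_of_notMem hy, indicator_of_notMem (show (y, z) ∉ T from fun h => hy h.1)]
      rfl
  -- `z`-sections (symmetry)
  have hsecZ : ∀ z, (fun y => T.indicator (1 : X × X → ℝ≥0∞) (y, z)) =
      A.indicator (fun _ => (C ∩ B z ρ).indicator (1 : X → ℝ≥0∞)) z := by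
    intro z; funext y
    by_cases hz : z ∈ A
    · rw [indicator_of_mem hz]
      by_cases hy : y ∈ C ∩ B z ρ
      · rw [indicator_of_mem hy, indicator_of_mem (show (y, z) ∈ T from ⟨hy.1, hz, (hsymm y z).2 hy.2⟩)]; rfl
      · rw [indicator_of_notMem hy,
          indicator_of_notMem (show (y, z) ∉ T from fun h => hy ⟨h.1, (hsymm y z).1 h.2.2⟩)]
    · rw [indicator_of_notMem hz, indicator_of_notMem (show (y, z) ∉ T from fun h => hz h.2.1)]
      rfl
  have hL : ∫⁻ y in C, μ (A ∩ B y ρ) ∂μ = ∫⁻ y, ∫⁻ z, T.indicator (1 : X × X → ℝ≥0∞) (y, z) ∂μ ∂μ := by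
    rw [← lintegral_indicator hC]
    refine lintegral_congr fun y => ?_
    rw [hsecY y]
    by_cases hy : y ∈ C
    · rw [indicator_of_mem hy, indicator_of_mem hy, lintegral_indicator_one (hA.inter (hB y))]
    · rw [indicator_of_notMem hy, indicator_of_notMem hy, Pi.zero_def, lintegral_zero]
  have hR : ∫⁻ z in A, μ (C ∩ B z ρ) ∂μ = ∫⁻ z, ∫⁻ y, T.indicator (1 : X × X → ℝ≥0∞) (y, z) ∂μ ∂μ := by
    rw [← lintegral_indicator hA]
    refine lintegral_congr fun z => ?_
    rw [hsecZ z]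
    by_cases hz : z ∈ A
    · rw [indicator_of_mem hz, indicator_of_mem hz, lintegral_indicator_one (hC.inter (hB z))]
    · rw [indicator_of_notMem hz, indicator_of_notMem hz, Pi.zero_def, lintegral_zero]
  rw [hL, hR]
  exact lintegral_lintegral_swap hF.aemeasurable

/-- **The doubling step**: if every `nHit κ n x` dominates `c · μ|_{B(x, ρ)}` and
`μ(B(x, ρ) ∩ B(z, ρ)) ≥ m` whenever `z ∈ B(x, ρ')`, then every `nHit κ (n + n) x` dominates
`(c·c·m) · μ|_{B(x, ρ')}`. -/
theorem chain_step {κ : Kernel X X} {n : ℕ} {ρ ρ' : ℝ} {c m : ℝ≥0∞}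
    (hN : MeasurableSet {p : X × X | p.2 ∈ B p.1 ρ}) (hsymm : ∀ y z, z ∈ B y ρ ↔ y ∈ B z ρ)
    (hB' : ∀ x, MeasurableSet (B x ρ'))
    (hP : ∀ x, c • μ.restrict (B x ρ) ≤ nHit κ n x)
    (hm : ∀ x z, z ∈ B x ρ' → m ≤ μ (B x ρ ∩ B z ρ)) :
    ∀ x, (c * c * m) • μ.restrict (B x ρ') ≤ nHit κ (n + n) x := by
  have hB : ∀ y, MeasurableSet (B y ρ) := measurableSet_ball_of_rel B hN
  intro x
  rw [nHit_add]
  refine Measure.le_iff.2 fun A hA => ?_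
  rw [Kernel.comp_apply' _ _ _ hA, Measure.smul_apply, Measure.restrict_apply hA, smul_eq_mul]
  -- measurability of `y ↦ μ (A ∩ B y ρ)`
  have hmeasF : Measurable fun y => μ (A ∩ B y ρ) :=
    measurable_measure_prodMk_left (ν := μ) ((measurable_snd hA).inter hN)
  -- pointwise lower bound from `hP`
  have h1 : ∀ y, c * μ (A ∩ B y ρ) ≤ nHit κ n y A := fun y => by
    have h := Measure.le_iff.1 (hP y) A hA
    rwa [Measure.smul_apply, Measure.restrict_apply hA, smul_eq_mul] at h
  calc c * c * m * μ (A ∩ B x ρ')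
      = c * (c * (m * μ (A ∩ B x ρ'))) := by ring
    _ ≤ c * (c * ∫⁻ z in A, μ (B x ρ ∩ B z ρ) ∂μ) := by
        gcongr
        calc m * μ (A ∩ B x ρ') = ∫⁻ _ in A ∩ B x ρ', m ∂μ := (MeasureTheory.setLIntegral_const _ _).symm
          _ ≤ ∫⁻ z in A ∩ B x ρ', μ (B x ρ ∩ B z ρ) ∂μ :=
              setLIntegral_mono' (hA.inter (hB' x)) fun z hz => hm x z hz.2
          _ ≤ ∫⁻ z in A, μ (B x ρ ∩ B z ρ) ∂μ :=
              lintegral_mono' (Measure.restrict_mono inter_subset_left le_rfl) le_rfl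
    _ = c * (c * ∫⁻ y in B x ρ, μ (A ∩ B y ρ) ∂μ) := by
        rw [lintegral_restrict_measure_inter_swap μ B hN hsymm (hB x) hA]
    _ = ∫⁻ y, c * μ (A ∩ B y ρ) ∂(c • μ.restrict (B x ρ)) := by
        rw [lintegral_smul_measure, lintegral_const_mul _ hmeasF, smul_eq_mul]
    _ ≤ ∫⁻ y, c * μ (A ∩ B y ρ) ∂(nHit κ n x) := lintegral_mono' (hP x) le_rfl
    _ ≤ ∫⁻ y, nHit κ n y A ∂(nHit κ n x) := lintegral_mono h1

/-- **Iterating the doubling**: with the halfway property at every radius, `nHit κ (2^j)` dominates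
`c_j · μ|_{B(x, (3/2)^j r)}` for some `c_j ≠ 0`. -/
theorem chain_iterate {κ : Kernel X X} {r : ℝ} {c : ℝ≥0∞}
    (hN : ∀ ρ, MeasurableSet {p : X × X | p.2 ∈ B p.1 ρ}) (hsymm : ∀ ρ y z, z ∈ B y ρ ↔ y ∈ B z ρ)
    (hhalf : ∀ ρ : ℝ, 0 < ρ → ∃ m : ℝ≥0∞, m ≠ 0 ∧ ∀ x z, z ∈ B x (3 / 2 * ρ) → m ≤ μ (B x ρ ∩ B z ρ))
    (hr : 0 < r) (hc : c ≠ 0) (hP : ∀ x, c • μ.restrict (B x r) ≤ κ x) (j : ℕ) :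
    ∃ cj : ℝ≥0∞, cj ≠ 0 ∧ ∀ x, cj • μ.restrict (B x ((3 / 2) ^ j * r)) ≤ nHit κ (2 ^ j) x := by
  induction j with
  | zero =>
      refine ⟨c, hc, fun x => ?_⟩
      rw [pow_zero, one_mul, pow_zero, show (1 : ℕ) = 0 + 1 from rfl, nHit_succ, nHit_zero, Kernel.comp_id]
      exact hP x
  | succ j ih =>
      obtain ⟨cj, hcj, hPj⟩ := ih
      obtain ⟨m, hm0, hm⟩ := hhalf ((3 / 2) ^ j * r) (by positivity)
      refine ⟨cj * cj * m, mul_ne_zero (mul_ne_zero hcj hcj) hm0, fun x => ?_⟩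
      have hstep := chain_step μ B (hN _) (hsymm _) (fun x => measurableSet_ball_of_rel B (hN _) x) hPj
        (ρ' := (3 / 2) ^ (j + 1) * r) (fun x z hz => hm x z (by rwa [pow_succ, mul_comm ((3/2 : ℝ) ^ j) (3/2), mul_assoc] at hz)) x
      rwa [← two_mul, ← pow_succ'] at hstep

/-- **THE ABSTRACT CHAINING LEMMA.**  If the balls exhaust the space beyond radius `R₀`
(`B x ρ = univ` for `ρ > R₀`), have the halfway property at every radius, and `κ x ≥ c · μ|_{B(x, r)}`
for all `x` (`r > 0`, `c ≠ 0`), then some power of `κ` is DOEBLIN: `c' • μ ≤ nHit κ (2^k) x` for all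
`x`, with `c' ≠ 0`. -/
theorem chain_cover {κ : Kernel X X} {r R₀ : ℝ} {c : ℝ≥0∞}
    (hN : ∀ ρ, MeasurableSet {p : X × X | p.2 ∈ B p.1 ρ}) (hsymm : ∀ ρ y z, z ∈ B y ρ ↔ y ∈ B z ρ)
    (hhalf : ∀ ρ : ℝ, 0 < ρ → ∃ m : ℝ≥0∞, m ≠ 0 ∧ ∀ x z, z ∈ B x (3 / 2 * ρ) → m ≤ μ (B x ρ ∩ B z ρ))
    (hfull : ∀ x ρ, R₀ < ρ → B x ρ = univ)
    (hr : 0 < r) (hc : c ≠ 0) (hP : ∀ x, c • μ.restrict (B x r) ≤ κ x) :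
    ∃ k : ℕ, ∃ c' : ℝ≥0∞, c' ≠ 0 ∧ ∀ x, c' • μ ≤ nHit κ (2 ^ k) x := by
  -- a radius `(3/2)^k r > R₀`
  obtain ⟨k, hk⟩ := pow_unbounded_of_one_lt (R₀ / r) (by norm_num : (1 : ℝ) < 3 / 2)
  have hk' : R₀ < (3 / 2) ^ k * r := by rwa [div_lt_iff₀ hr] at hk
  obtain ⟨cj, hcj, hPj⟩ := chain_iterate μ B hN hsymm hhalf hr hc hP k
  refine ⟨k, cj, hcj, fun x => ?_⟩
  have h := hPj x
  rwa [hfull x _ hk', Measure.restrict_univ] at h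

end Abstract

/-! ## §2 The sphere -/

section Sphere

variable {m : Type*} [Fintype m] [DecidableEq m] [Nonempty m]

omit [DecidableEq m] [Nonempty m] in
/-- The angle is jointly continuous on `S × S`. -/
theorem continuous_angle_sphere₂ :
    Continuous fun p : (sphere (0 : EuclideanSpace ℝ m) 1) × (sphere (0 : EuclideanSpace ℝ m) 1) =>
      angle (p.1 : EuclideanSpace ℝ m) (p.2 : EuclideanSpace ℝ m) := by
  unfold InnerProductGeometry.angle
  refine Real.continuous_arccos.comp (((continuous_subtype_val.comp continuous_fst).inner
    (continuous_subtype_val.comp continuous_snd)).div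
    ((continuous_norm.comp (continuous_subtype_val.comp continuous_fst)).mul
      (continuous_norm.comp (continuous_subtype_val.comp continuous_snd))) fun p => ?_)
  rw [norm_eq_of_mem_sphere p.1, norm_eq_of_mem_sphere p.2]
  norm_num

omit [DecidableEq m] [Nonempty m] in
/-- The neighbour relation `{(y, z) : angle y z < ρ}` is measurable. -/
theorem measurableSet_angle_lt (ρ : ℝ) :
    MeasurableSet {p : (sphere (0 : EuclideanSpace ℝ m) 1) × (sphere (0 : EuclideanSpace ℝ m) 1) |
      p.2 ∈ sphereCap p.1 ρ} :=
  (isOpen_lt continuous_angle_sphere₂ continuous_const).measurableSet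

/-- **The halfway property of caps**: for `z ∈ cap(x, 3ρ/2)`, `σ(cap(x, ρ) ∩ cap(z, ρ)) ≥ σ(cap(·, ρ/4)) > 0`
(the cap of radius `ρ/4` around the halfway point lies in both). -/
theorem uniformSphere_cap_inter_cap_ge (h2 : 2 ≤ Fintype.card m) {ρ : ℝ}
    (x₀ x z : sphere (0 : EuclideanSpace ℝ m) 1) (hz : z ∈ sphereCap x (3 / 2 * ρ)) :
    uniformSphere (volume : Measure (EuclideanSpace ℝ m)) (sphereCap x₀ (ρ / 4)) ≤
      uniformSphere (volume : Measure (EuclideanSpace ℝ m)) (sphereCap x ρ ∩ sphereCap z ρ) := by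
  obtain ⟨w, hxw, hzw⟩ := exists_halfway h2 x z
  rw [mem_sphereCap] at hz
  have hsub : sphereCap w (ρ / 4) ⊆ sphereCap x ρ ∩ sphereCap z ρ :=
    sphereCap_subset_inter (by linarith) (by linarith)
  rw [uniformSphere_sphereCap_eq h2 x₀ w]
  exact measure_mono hsub

/-- **CAP CHAINING ON THE SPHERE** (`dim ≥ 2`).  If a Markov kernel on the sphere dominates, from every
point, `c` times the uniform law restricted to the cap of radius `r` around it (`r > 0`, `c ≠ 0`), then
some power `nHit κ (2^k)` is Doeblin: `c' • σ ≤ nHit κ (2^k) x` for every `x`, with `c' ≠ 0`. -/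
theorem sphereCap_chaining (h2 : 2 ≤ Fintype.card m)
    {κ : Kernel (sphere (0 : EuclideanSpace ℝ m) 1) (sphere (0 : EuclideanSpace ℝ m) 1)}
    {r : ℝ} {c : ℝ≥0∞} (hr : 0 < r) (hc : c ≠ 0)
    (hκ : ∀ x, c • (uniformSphere (volume : Measure (EuclideanSpace ℝ m))).restrict (sphereCap x r) ≤ κ x) :
    ∃ k : ℕ, ∃ c' : ℝ≥0∞, c' ≠ 0 ∧
      ∀ x, c' • uniformSphere (volume : Measure (EuclideanSpace ℝ m)) ≤ nHit κ (2 ^ k) x := by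
  obtain ⟨x₀⟩ : Nonempty (sphere (0 : EuclideanSpace ℝ m) 1) :=
    ⟨⟨EuclideanSpace.single (Classical.arbitrary m) 1, by simp⟩⟩
  refine chain_cover (uniformSphere (volume : Measure (EuclideanSpace ℝ m))) sphereCap (R₀ := π)
    (fun ρ => measurableSet_angle_lt ρ) (fun ρ y z => ?_) (fun ρ hρ => ?_) (fun x ρ hρ => sphereCap_eq_univ x hρ)
    hr hc hκ
  · simp only [mem_sphereCap, angle_comm]
  · exact ⟨_, (uniformSphere_sphereCap_pos h2 x₀ (by positivity : 0 < ρ / 4)).ne',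
      fun x z hz => uniformSphere_cap_inter_cap_ge h2 x₀ x z hz⟩

end Sphere

end Summit.Ventures.LatticeQCDFlow.Exactness
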